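import Summits.AtomisticToContinuum.Crystallization.Theses.ChessboardParticlePlanes
import Summits.AtomisticToContinuum.Crystallization.Theorems.ChessboardParticlePlanesLjPlaneChessboardReduction
import Summits.AtomisticToContinuum.Crystallization.Theorems.ChessboardParticlePlanesLjPlaneChessboardHorizontalBasis
import Summits.AtomisticToContinuum.Crystallization.Theorems.ChessboardParticlePlanesLjPlaneChessboardVerticalPeriod
import Summits.AtomisticToContinuum.Crystallization.Theorems.ChessboardParticlePlanesLjPlaneChessboardHeightEnumeration
import Summits.AtomisticToContinuum.Crystallization.Theorems.ChessboardParticlePlanesLjPlaneChessboardLayerPresentation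
import Summits.AtomisticToContinuum.Crystallization.Theorems.ChessboardParticlePlanesLjPlaneChessboardPlanarLattice
import Summits.AtomisticToContinuum.Crystallization.Theorems.ChessboardParticlePlanesLjPlaneChessboardMotifToLayers
import Summits.AtomisticToContinuum.Crystallization.Theorems.ChessboardParticlePlanesLjPlaneChessboardDeficitKernel
import Summits.AtomisticToContinuum.Crystallization.Theorems.ChessboardParticlePlanesLjPlaneChessboardSliceIdentity
import Summits.AtomisticToContinuum.Crystallization.Theorems.ChessboardParticlePlanesLjPlaneChessboardCrossKernelFourier
import Literature.Algebra.EuclideanLattices.DualLattice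

/-!
# Crux `LjPlaneChessboard` (stmt-AtomisticToContinuum-6709) — line `twolayer-margin`
(crux-strategist s1, 2026-08-17; ALTERNATIVE to the lead's line `Sketch`, never registered over it)

The lead's skeleton v9 has ONE open stub, `stub_kernelFormNonneg`: the motif-summed chessboard deficit,
written as a finite planar matrix-kernel lattice form, is `≥ 0`; its intended proof is ONE radial
hard-core certificate transported across all offsets and made to dominate the unequal-gap 2×2 blocks
(LP v1–v3 void/artefact/infeasible, 2×2 block singular with one transport rate, uniform column PSD open).

This line CUTS THE SAME STATEMENT DIFFERENTLY and is certificate-free: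

* `stub_modeSliceForm` (M, pure bookkeeping over landed lemmas `kernelEntry_fourier`,
  `kernelForm_eq_entrySum`, `latticeForm_hasSum_periodise`, Fubini): the kernel form EQUALS
  `4π / covol(L) · Σ'_{w ∈ L*} ∫_{λ > 2π‖w‖} W(2π‖w‖, λ) · LHS_w(λ) dλ`, where `LHS_w(λ)` is literally the
  left-hand side of the landed exponential-slice identity `stub_sliceIdentity` (p105431) evaluated at the
  layer structure amplitudes `a_j(w) = Σ_{f ∈ F j} e^{2πi⟪f̄, w⟫}` and the slice `x = e^{-λ}` — hence, by that
  identity, a λ-integral of `W(q_w, λ) · Σ_i |M_i|²/(1 - e^{-2λc_i})`, signed only through `W`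
  (`sliceWeight_signChange`: `W < 0` iff `(λ²-q²)³ > 302400`, i.e. `λ > 8.19`).
* `stub_hierarchyReduction` (M/L, the new lemma, exact): the Markov property of the upward field turns the slice
  mismatch into the BLOCK RELATION `M_i = N_i + ρ_i M_{i+1}`, `ρ_i = (1-s_i²)s_{i+1}/(1-s_{i+1}²) ≤ s̄/(1-s̄²)`,
  where `N_i = [s_{i+1}(1-s_i²)a_{i+2} + (s_{i+1}²-s_i²)a_{i+1} - s_i(1-s_{i+1}²)a_i]/(1-s_{i+1}²)` involves ONLY the block
  `(i, i+1, i+2)` and its two gaps; two-sided `ℓ²` bounds `(1∓ρ̄)` (all gap sequences, twist-invariant) and the per-slice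
  budget `α(λ) = 4e^{-3λ/4} ≥ (1-ρ̄)⁻²-1` on `λ ≥ 3` give `∫WΣ|M_i|²/(1-s_i²) ≥ Σ_i ∫_{λ≥3}(W-α|W|)|N_i|²/(1-s_i²)` mode by mode;
  slices `λ < 3` are dropped (`W ≥ 0` there).
* `stub_blockCore` (XL, THE CORE — research-level, method-agnostic; the three-layer block inequality):
  for three `2/3`-separated `L`-periodic layers and gaps `c₁, c₂ ≥ 3/4`, the deformed mode/slice form of the block
  mismatch — the block reflected through its top plane minus the block translated by twice its bottom gap — is `≥ 0`.
  Equal gaps: exactly the cards' two-layer inequality `E2(σ₀,σ₂;2c) ≥ 0` (mirror layer drops out; worst known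
  mode-sign ratio 4.06e-3, j023430; the card's `Ψ = (148+Δ)(u₁⋆u₁+u₂⋆u₂)` certifies these instances numerically);
  unequal gaps: the mirror layer enters at second order and `G = 0` is strictly coercive.  The deformation moves
  `q*(3/2) = 12.317` by < 0.003.  What the core is freed of: the multi-layer hierarchy, transport across offsets,
  image sums, Bloch phases — where the lead's recorded dead ends live.

Composition (kernel-checked, no sorry outside the three stubs): `kernelFormNonneg_of` :=
`stub_modeSliceForm` ▸ `(4π/covol ≥ 0) · stub_hierarchyReduction stub_blockCore`; then the
lead's v9 bookkeeping verbatim (`stub_verticalPeriod`, `heightEnumeration`, `layerPresentation_periodic`,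
`planarLattice`, `deficit_motif_to_layers`, `deficitSite_kernelForm`, `stub_horizontalBasis`) gives the
per-site deficit inequality and the landed `stub_reduction` (p113745) closes `LjPlaneChessboard` BY NAME.

Card: `Cruxes/LjPlaneChessboard/Lines/twolayer-margin.md`; census: `Cruxes/LjPlaneChessboard/STRATEGY-CENSUS.md`.
[cite: GiulianiLebowitzLieb2008, Lemma 1; FrohlichEtAl1978, Thm 3.1; GiulianiLebowitzLieb2006, §3]
-/

noncomputable section

namespace Summit.AtomisticToContinuum.Crystallization.Cruxes.LjPlaneChessboard.TwoLayerMargin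

open Literature.MathematicalPhysics.StatisticalMechanics
open Literature.Algebra.EuclideanLattices
open Summit.AtomisticToContinuum.Crystallization.Theorems.ChessboardParticlePlanesLjPlaneChessboard
open scoped Real InnerProductSpace FourierTransform

/-- **Stub C — THE CORE: the three-layer block reflection inequality (XL, research-level, certificate-free).**
For a planar lattice `L`, three finite motifs `F₀, F₁, F₂` whose `L`-periodisations are `2/3`-separated (the
layers `i, i+1, i+2` of a stack) and the two gaps `c₁, c₂ ≥ 3/4` between them, the mode/slice form of the block
mismatch `Ñ = e^{-λc₂}(1-e^{-2λc₁})S_{F₂} + (e^{-2λc₂}-e^{-2λc₁})S_{F₁} - e^{-λc₁}(1-e^{-2λc₂})S_{F₀}` — i.e. the block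
`(σ₀,σ₁,σ₂)` REFLECTED THROUGH ITS TOP PLANE minus the block TRANSLATED UP BY TWICE ITS BOTTOM GAP, both seen from the
middle plane — weighted by the deformed slice weight `(W - 4e^{-3λ/4}|W|)/((1-e^{-2λc₁})(1-e^{-2λc₂})²)` on
`λ > max(2π‖w‖, 3)`, is `≥ 0` (`S_F(w) = Σ_{f∈F} e^{2πi⟪f,w⟫}`, `W` the landed slice weight of `fourier_ljCrossKernel`).
For equal gaps `c₁ = c₂ = c` the `S_{F₁}` term vanishes and this is EXACTLY the two-layer offset-negative-type
inequality `E2(σ₀, σ₂; 2c) ≥ 0` of the idea cards with the restack image weight `1/(1-e^{-2λc})` (worst known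
mode-sign ratio NEG/POS over realizable pairs 4.06e-3, j023430; the card's radial certificate `Ψ` addresses these
instances); for `c₁ ≠ c₂` the mirror layer enters with the second-order coefficient `e^{-2λc₂} - e^{-2λc₁}` and the
`G = 0` channel is strictly coercive (log-convexity of `u ↦ K̂_u(0)`).  The deformation `α(λ) = 4e^{-3λ/4}` is the
exact per-slice budget of `stub_hierarchyReduction` (it needs `(1-ρ̄)⁻² - 1 ≤ 2.3e^{-3λ/4}`); it moves the sign change of
the block multiplier from `q*(3/2) = 12.317` by < 0.003.  Not a strengthening in substance: it is the crux restricted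
to the stacks in which only one block is active.  [difficulty: XL] [cite: FrohlichEtAl1978, Thm 3.1;
GiulianiLebowitzLieb2008, Lemma 1] -/
theorem stub_blockCore :
    ∀ (L : Submodule ℤ (EuclideanSpace ℝ (Fin 2))) [DiscreteTopology L] [IsZLattice ℝ L]
      (F₀ F₁ F₂ : Finset (EuclideanSpace ℝ (Fin 2))) (c₁ c₂ : ℝ),
      (∀ f ∈ F₀, ∀ f' ∈ F₀, ∀ v ∈ L, f ≠ f' + v → (2 : ℝ) / 3 ≤ dist f (f' + v)) →
      (∀ f ∈ F₁, ∀ f' ∈ F₁, ∀ v ∈ L, f ≠ f' + v → (2 : ℝ) / 3 ≤ dist f (f' + v)) →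
      (∀ f ∈ F₂, ∀ f' ∈ F₂, ∀ v ∈ L, f ≠ f' + v → (2 : ℝ) / 3 ≤ dist f (f' + v)) →
      (3 : ℝ) / 4 ≤ c₁ → (3 : ℝ) / 4 ≤ c₂ →
      0 ≤ (∑' w : dualLattice L, ∫ l in Set.Ioi (max (2 * π * ‖(w : EuclideanSpace ℝ (Fin 2))‖) (3 : ℝ)),
            (((l ^ 2 - (2 * π * ‖(w : EuclideanSpace ℝ (Fin 2))‖) ^ 2) * Real.sqrt (l ^ 2 - (2 * π * ‖(w : EuclideanSpace ℝ (Fin 2))‖) ^ 2) / 144 - (l ^ 2 - (2 * π * ‖(w : EuclideanSpace ℝ (Fin 2))‖) ^ 2) ^ 4 * Real.sqrt (l ^ 2 - (2 * π * ‖(w : EuclideanSpace ℝ (Fin 2))‖) ^ 2) / 43545600)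
              - (4 : ℝ) * Real.exp (-(3 * l / 4)) * |((l ^ 2 - (2 * π * ‖(w : EuclideanSpace ℝ (Fin 2))‖) ^ 2) * Real.sqrt (l ^ 2 - (2 * π * ‖(w : EuclideanSpace ℝ (Fin 2))‖) ^ 2) / 144 - (l ^ 2 - (2 * π * ‖(w : EuclideanSpace ℝ (Fin 2))‖) ^ 2) ^ 4 * Real.sqrt (l ^ 2 - (2 * π * ‖(w : EuclideanSpace ℝ (Fin 2))‖) ^ 2) / 43545600)|)
            * (‖((Real.exp (-(l * c₂)) * (1 - Real.exp (-(2 * (l * c₁)))) : ℝ) : ℂ) * (∑ f ∈ F₂, Complex.exp (2 * π * Complex.I * (⟪f, (w : EuclideanSpace ℝ (Fin 2))⟫_ℝ : ℂ))) + ((Real.exp (-(2 * (l * c₂))) - Real.exp (-(2 * (l * c₁))) : ℝ) : ℂ) * (∑ f ∈ F₁, Complex.exp (2 * π * Complex.I * (⟪f, (w : EuclideanSpace ℝ (Fin 2))⟫_ℝ : ℂ))) - ((Real.exp (-(l * c₁)) * (1 - Real.exp (-(2 * (l * c₂)))) : ℝ) : ℂ) * (∑ f ∈ F₀, Complex.exp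 (2 * π * Complex.I * (⟪f, (w : EuclideanSpace ℝ (Fin 2))⟫_ℝ : ℂ)))‖ ^ 2
               / ((1 - Real.exp (-(2 * (l * c₁)))) * (1 - Real.exp (-(2 * (l * c₂)))) ^ 2))) := by
  sorry

/-- **Stub B — hierarchy reduction (M/L, exact algebra + bookkeeping): the block core implies positivity of the
mode/slice form of the motif-summed chessboard deficit for every admissible layered presentation.**
Ingredients, all exact: (1) `stub_sliceIdentity` (p105431): `LHS_w(λ) = Σ_{i<n} |M_i|²/(1-s_i²)`,
`M_i = (1-s_i²)U_{i+1} - s_ia_i - s_i²a_{i+1}`, `s_i = e^{-λc_i}`; (2) the Markov property `U_{i+1} = s_{i+1}(a_{i+2} + U_{i+2})`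
gives the BLOCK RELATION `M_i = N_i + ρ_i M_{i+1}` with `ρ_i = (1-s_i²)s_{i+1}/(1-s_{i+1}²)` and
`N_i = [s_{i+1}(1-s_i²)a_{i+2} + (s_{i+1}²-s_i²)a_{i+1} - s_i(1-s_{i+1}²)a_i]/(1-s_{i+1}²)` (checked: job j023690 part 1);
(3) in the weighted norm `‖x‖² = Σ_i|x_i|²/(1-s_i²)` over one period (twist-invariant) the shift `(RM)_i = ρ_iM_{i+1}` has
`‖R‖ ≤ ρ̄ := s̄/√(1-s̄²)`, `s̄ = e^{-3λ/4}`, so `(1-ρ̄)²‖M‖² ≤ ‖N‖² ≤ (1+ρ̄)²‖M‖²` for ALL gap sequences; (4) drop the slices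
`λ < 3` (`W ≥ 0` there, `sliceWeight_signChange`), and on `λ ≥ 3` use `W‖M‖² ≥ (W - α|W|)‖N‖²` slice by slice, valid because
`α(λ) = 4e^{-3λ/4} ≥ (1-ρ̄)⁻² - 1`; (5) `|N_i|²/(1-s_i²)` is the core's integrand for `(F₀,F₁,F₂) =` planar motifs of layers
`(i, i+1, i+2)` and `(c₁,c₂) = (c_i, c_{i+1})` (no image expansion needed); sum the core over `i < n` (Fubini/`tsum` of
nonnegatives).  Design checks: j023690 (identity + chain, random and adversarial incl. gaps up to 2.5); the earlier TWO-layer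
main term `m_i = s_{i+1}a_{i+2} - s_ia_i` (v2 of this line) missed the restack image `-s_i²a_{i+1}` and its chain is beaten
adversarially at q = 8 (j023600) when `c_{i+1} > 2c_i` — recorded so nobody re-types it. -/
theorem stub_hierarchyReduction :
    (∀ (L : Submodule ℤ (EuclideanSpace ℝ (Fin 2))) [DiscreteTopology L] [IsZLattice ℝ L]
      (F₀ F₁ F₂ : Finset (EuclideanSpace ℝ (Fin 2))) (c₁ c₂ : ℝ),
      (∀ f ∈ F₀, ∀ f' ∈ F₀, ∀ v ∈ L, f ≠ f' + v → (2 : ℝ) / 3 ≤ dist f (f' + v)) →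
      (∀ f ∈ F₁, ∀ f' ∈ F₁, ∀ v ∈ L, f ≠ f' + v → (2 : ℝ) / 3 ≤ dist f (f' + v)) →
      (∀ f ∈ F₂, ∀ f' ∈ F₂, ∀ v ∈ L, f ≠ f' + v → (2 : ℝ) / 3 ≤ dist f (f' + v)) →
      (3 : ℝ) / 4 ≤ c₁ → (3 : ℝ) / 4 ≤ c₂ →
      0 ≤ (∑' w : dualLattice L, ∫ l in Set.Ioi (max (2 * π * ‖(w : EuclideanSpace ℝ (Fin 2))‖) (3 : ℝ)),
            (((l ^ 2 - (2 * π * ‖(w : EuclideanSpace ℝ (Fin 2))‖) ^ 2) * Real.sqrt (l ^ 2 - (2 * π * ‖(w : EuclideanSpace ℝ (Fin 2))‖) ^ 2) / 144 - (l ^ 2 - (2 * π * ‖(w : EuclideanSpace ℝ (Fin 2))‖) ^ 2) ^ 4 * Real.sqrt (l ^ 2 - (2 * π * ‖(w : EuclideanSpace ℝ (Fin 2))‖) ^ 2) / 43545600)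
              - (4 : ℝ) * Real.exp (-(3 * l / 4)) * |((l ^ 2 - (2 * π * ‖(w : EuclideanSpace ℝ (Fin 2))‖) ^ 2) * Real.sqrt (l ^ 2 - (2 * π * ‖(w : EuclideanSpace ℝ (Fin 2))‖) ^ 2) / 144 - (l ^ 2 - (2 * π * ‖(w : EuclideanSpace ℝ (Fin 2))‖) ^ 2) ^ 4 * Real.sqrt (l ^ 2 - (2 * π * ‖(w : EuclideanSpace ℝ (Fin 2))‖) ^ 2) / 43545600)|)
            * (‖((Real.exp (-(l * c₂)) * (1 - Real.exp (-(2 * (l * c₁)))) : ℝ) : ℂ) * (∑ f ∈ F₂, Complex.exp (2 * π * Complex.I * (⟪f, (w : EuclideanSpace ℝ (Fin 2))⟫_ℝ : ℂ))) + ((Real.exp (-(2 * (l * c₂))) - Real.exp (-(2 * (l * c₁))) : ℝ) : ℂ) * (∑ f ∈ F₁, Complex.exp (2 * π * Complex.I * (⟪f, (w : EuclideanSpace ℝ (Fin 2))⟫_ℝ : ℂ))) - ((Real.exp (-(l * c₁)) * (1 - Real.exp (-(2 * (l * c₂)))) : ℝ) : ℂ) * (∑ f ∈ F₀, Complex.exp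 (2 * π * Complex.I * (⟪f, (w : EuclideanSpace ℝ (Fin 2))⟫_ℝ : ℂ)))‖ ^ 2
               / ((1 - Real.exp (-(2 * (l * c₁)))) * (1 - Real.exp (-(2 * (l * c₂)))) ^ 2)))) →
    ∀ (Q : PeriodicConfiguration 3) (τu τd : ℝ → ℝ) (a b g₀ : EuclideanSpace ℝ (Fin 3))
      (z : ℤ → ℝ) (n : ℕ) (F : ℤ → Finset (EuclideanSpace ℝ (Fin 3)))
      (L : Submodule ℤ (EuclideanSpace ℝ (Fin 2))) [DiscreteTopology L] [IsZLattice ℝ L],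
      (∀ x ∈ Q.points, ∀ y ∈ Q.points, x ≠ y → (2 : ℝ) / 3 ≤ dist x y) →
      (∀ x' ∈ Q.points, ∀ y ∈ Q.points, x' 2 ≠ y 2 → (3 : ℝ) / 4 ≤ |x' 2 - y 2|) →
      (∀ t : ℝ, (∃ x ∈ Q.points, x 2 = t) →
        (t < τu t ∧ (∃ x ∈ Q.points, x 2 = τu t) ∧ (∀ x ∈ Q.points, x 2 ≤ t ∨ τu t ≤ x 2)) ∧
        (τd t < t ∧ (∃ x ∈ Q.points, x 2 = τd t) ∧ (∀ x ∈ Q.points, x 2 ≤ τd t ∨ t ≤ x 2))) →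
      a ∈ Q.lattice → b ∈ Q.lattice → a 2 = 0 → b 2 = 0 → LinearIndependent ℝ ![a, b] →
      (∀ g ∈ Q.lattice, g 2 = 0 → ∃ k l : ℤ, g = (k : ℝ) • a + (l : ℝ) • b) →
      (∀ v : EuclideanSpace ℝ (Fin 2),
        v ∈ L ↔ ∃ k l : ℤ, v = (k : ℝ) • !₂[a 0, a 1] + (l : ℝ) • !₂[b 0, b 1]) →
      g₀ ∈ Q.lattice → 0 < n → StrictMono z → (∀ i : ℤ, z (i + n) = z i + g₀ 2) →
      (∀ g ∈ Q.lattice, ∃ k : ℤ, g 2 = g₀ 2 * k) →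
      (∀ y ∈ Q.points, ∃ i : ℤ, y 2 = z i) → (∀ i : ℤ, ∃ y ∈ Q.points, y 2 = z i) →
      (∀ i : ℤ, z (i + 1) = τu (z i)) → (∀ i : ℤ, τd (z (i + 1)) = z i) →
      (∀ m : ℤ, ∀ f ∈ F m, f 2 = z m ∧ f ∈ Q.points) →
      (∀ m : ℤ, ∀ f ∈ F m, ∀ f' ∈ F m, f ≠ f' → ∀ k l : ℤ, f' ≠ f + (k : ℝ) • a + (l : ℝ) • b) →
      (∀ (m : ℤ) (y : EuclideanSpace ℝ (Fin 3)),
        (y ∈ Q.points ∧ y 2 = z m) ↔ ∃ f ∈ F m, ∃ k l : ℤ, y = f + (k : ℝ) • a + (l : ℝ) • b) →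
      (∀ m : ℤ, F (m + n) = (F m).image (fun f => f + g₀)) →
      0 ≤ ∑' w : dualLattice L, ∫ l in Set.Ioi (2 * π * ‖(w : EuclideanSpace ℝ (Fin 2))‖),
          ((l ^ 2 - (2 * π * ‖(w : EuclideanSpace ℝ (Fin 2))‖) ^ 2) * Real.sqrt (l ^ 2 - (2 * π * ‖(w : EuclideanSpace ℝ (Fin 2))‖) ^ 2) / 144 - (l ^ 2 - (2 * π * ‖(w : EuclideanSpace ℝ (Fin 2))‖) ^ 2) ^ 4 * Real.sqrt (l ^ 2 - (2 * π * ‖(w : EuclideanSpace ℝ (Fin 2))‖) ^ 2) / 43545600)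
          * ∑ i ∈ Finset.range n,
            ((2 * ((∑ f ∈ F ((i : ℤ)), Complex.exp (2 * π * Complex.I * (⟪(!₂[f 0, f 1] : EuclideanSpace ℝ (Fin 2)), (w : EuclideanSpace ℝ (Fin 2))⟫_ℝ : ℂ))) * starRingEnd ℂ (∑ f ∈ F ((i : ℤ) + 1), Complex.exp (2 * π * Complex.I * (⟪(!₂[f 0, f 1] : EuclideanSpace ℝ (Fin 2)), (w : EuclideanSpace ℝ (Fin 2))⟫_ℝ : ℂ)))).re
                  * Real.exp (-(l * (z (((i : ℤ)) + 1) - z ((i : ℤ)))))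
                + (‖(∑ f ∈ F ((i : ℤ)), Complex.exp (2 * π * Complex.I * (⟪(!₂[f 0, f 1] : EuclideanSpace ℝ (Fin 2)), (w : EuclideanSpace ℝ (Fin 2))⟫_ℝ : ℂ)))‖ ^ 2 + ‖(∑ f ∈ F ((i : ℤ) + 1), Complex.exp (2 * π * Complex.I * (⟪(!₂[f 0, f 1] : EuclideanSpace ℝ (Fin 2)), (w : EuclideanSpace ℝ (Fin 2))⟫_ℝ : ℂ)))‖ ^ 2)
                  * Real.exp (-(2 * (l * (z (((i : ℤ)) + 1) - z ((i : ℤ)))))))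
                / (1 - Real.exp (-(2 * (l * (z (((i : ℤ)) + 1) - z ((i : ℤ)))))))
              - 2 * ((∑ f ∈ F ((i : ℤ)), Complex.exp (2 * π * Complex.I * (⟪(!₂[f 0, f 1] : EuclideanSpace ℝ (Fin 2)), (w : EuclideanSpace ℝ (Fin 2))⟫_ℝ : ℂ))) * starRingEnd ℂ
                  (∑' k : ℕ, (Real.exp (-(l * (z ((i : ℤ) + 1 + k) - z (i : ℤ)))) : ℂ)
                    * (∑ f ∈ F ((i : ℤ) + 1 + (k : ℤ)), Complex.exp (2 * π * Complex.I * (⟪(!₂[f 0, f 1] : EuclideanSpace ℝ (Fin 2)), (w : EuclideanSpace ℝ (Fin 2))⟫_ℝ : ℂ))))).re) := by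
  sorry

/-- **Stub A — mode/slice form of the kernel form (M, bookkeeping over landed lemmas).**
Poisson summation over `L` of each kernel entry (`kernelForm_eq_entrySum`, `latticeForm_hasSum_periodise`),
the explicit planar transform of the entries (`kernelEntry_fourier` = phases × `-2π ∫_{λ>q} W e^{-λ|Δz|}`),
exchange of the finite sums with the λ-integral, and the identification of the resulting vertical
exponential-kernel combination with `-2 ×` the left-hand side of `stub_sliceIdentity` at the structure
amplitudes `a_j(w) = Σ_{f ∈ F j} e^{2πi⟪f̄,w⟫}` (the `w ↦ -w` symmetry makes the total real). -/
theorem stub_modeSliceForm :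
    ∀ (Q : PeriodicConfiguration 3) (τu τd : ℝ → ℝ) (a b g₀ : EuclideanSpace ℝ (Fin 3))
      (z : ℤ → ℝ) (n : ℕ) (F : ℤ → Finset (EuclideanSpace ℝ (Fin 3)))
      (L : Submodule ℤ (EuclideanSpace ℝ (Fin 2))) [DiscreteTopology L] [IsZLattice ℝ L],
      (∀ x ∈ Q.points, ∀ y ∈ Q.points, x ≠ y → (2 : ℝ) / 3 ≤ dist x y) →
      (∀ x' ∈ Q.points, ∀ y ∈ Q.points, x' 2 ≠ y 2 → (3 : ℝ) / 4 ≤ |x' 2 - y 2|) →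
      (∀ t : ℝ, (∃ x ∈ Q.points, x 2 = t) →
        (t < τu t ∧ (∃ x ∈ Q.points, x 2 = τu t) ∧ (∀ x ∈ Q.points, x 2 ≤ t ∨ τu t ≤ x 2)) ∧
        (τd t < t ∧ (∃ x ∈ Q.points, x 2 = τd t) ∧ (∀ x ∈ Q.points, x 2 ≤ τd t ∨ t ≤ x 2))) →
      a ∈ Q.lattice → b ∈ Q.lattice → a 2 = 0 → b 2 = 0 → LinearIndependent ℝ ![a, b] →
      (∀ g ∈ Q.lattice, g 2 = 0 → ∃ k l : ℤ, g = (k : ℝ) • a + (l : ℝ) • b) →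
      (∀ v : EuclideanSpace ℝ (Fin 2),
        v ∈ L ↔ ∃ k l : ℤ, v = (k : ℝ) • !₂[a 0, a 1] + (l : ℝ) • !₂[b 0, b 1]) →
      g₀ ∈ Q.lattice → 0 < n → StrictMono z → (∀ i : ℤ, z (i + n) = z i + g₀ 2) →
      (∀ g ∈ Q.lattice, ∃ k : ℤ, g 2 = g₀ 2 * k) →
      (∀ y ∈ Q.points, ∃ i : ℤ, y 2 = z i) → (∀ i : ℤ, ∃ y ∈ Q.points, y 2 = z i) →
      (∀ i : ℤ, z (i + 1) = τu (z i)) → (∀ i : ℤ, τd (z (i + 1)) = z i) →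
      (∀ m : ℤ, ∀ f ∈ F m, f 2 = z m ∧ f ∈ Q.points) →
      (∀ m : ℤ, ∀ f ∈ F m, ∀ f' ∈ F m, f ≠ f' → ∀ k l : ℤ, f' ≠ f + (k : ℝ) • a + (l : ℝ) • b) →
      (∀ (m : ℤ) (y : EuclideanSpace ℝ (Fin 3)),
        (y ∈ Q.points ∧ y 2 = z m) ↔ ∃ f ∈ F m, ∃ k l : ℤ, y = f + (k : ℝ) • a + (l : ℝ) • b) →
      (∀ m : ℤ, F (m + n) = (F m).image (fun f => f + g₀)) →
      ∑ i₀ ∈ Finset.range n, ∑ x ∈ F i₀,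
        ∑ m ∈ Finset.range n, ∑ f' ∈ F m, ∑' v : L,
        ∑' j : ℤ,
          ((if (m : ℤ) + j * n = (i₀ : ℤ) then 0 else
              2 * lennardJones (Real.sqrt
                (‖!₂[x 0, x 1] - !₂[f' 0, f' 1] - (j : ℝ) • !₂[g₀ 0, g₀ 1]
                    - (v : EuclideanSpace ℝ (Fin 2))‖ ^ 2 + (z (i₀ : ℤ) - z ((m : ℤ) + j * n)) ^ 2)))
            - (if (m : ℤ) + j * n = (i₀ : ℤ) then
                ∑' k : {k : ℤ // k ≠ 0},
                  (lennardJones (Real.sqrt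
                      (‖!₂[x 0, x 1] - !₂[f' 0, f' 1] - (v : EuclideanSpace ℝ (Fin 2))‖ ^ 2
                        + (2 * |(k : ℝ)| * (z ((i₀ : ℤ) + 1) - z (i₀ : ℤ))) ^ 2)) +
                   lennardJones (Real.sqrt
                      (‖!₂[x 0, x 1] - !₂[f' 0, f' 1] - (v : EuclideanSpace ℝ (Fin 2))‖ ^ 2
                        + (2 * |(k : ℝ)| * (z (i₀ : ℤ) - z ((i₀ : ℤ) - 1))) ^ 2)))
               else 0)
            - (if (m : ℤ) + j * n = (i₀ : ℤ) + 1 then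
                ∑' k : ℤ, lennardJones (Real.sqrt
                  (‖!₂[x 0, x 1] - !₂[f' 0, f' 1] - (j : ℝ) • !₂[g₀ 0, g₀ 1]
                      - (v : EuclideanSpace ℝ (Fin 2))‖ ^ 2
                    + (|2 * (k : ℝ) + 1| * (z ((i₀ : ℤ) + 1) - z (i₀ : ℤ))) ^ 2))
               else 0)
            - (if (m : ℤ) + j * n = (i₀ : ℤ) - 1 then
                ∑' k : ℤ, lennardJones (Real.sqrt
                  (‖!₂[x 0, x 1] - !₂[f' 0, f' 1] - (j : ℝ) • !₂[g₀ 0, g₀ 1]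
                      - (v : EuclideanSpace ℝ (Fin 2))‖ ^ 2
                    + (|2 * (k : ℝ) + 1| * (z (i₀ : ℤ) - z ((i₀ : ℤ) - 1))) ^ 2))
               else 0))
        = 4 * π / ZLattice.covolume L *
        ∑' w : dualLattice L, ∫ l in Set.Ioi (2 * π * ‖(w : EuclideanSpace ℝ (Fin 2))‖),
          ((l ^ 2 - (2 * π * ‖(w : EuclideanSpace ℝ (Fin 2))‖) ^ 2) * Real.sqrt (l ^ 2 - (2 * π * ‖(w : EuclideanSpace ℝ (Fin 2))‖) ^ 2) / 144 - (l ^ 2 - (2 * π * ‖(w : EuclideanSpace ℝ (Fin 2))‖) ^ 2) ^ 4 * Real.sqrt (l ^ 2 - (2 * π * ‖(w : EuclideanSpace ℝ (Fin 2))‖) ^ 2) / 43545600)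
          * ∑ i ∈ Finset.range n,
            ((2 * ((∑ f ∈ F ((i : ℤ)), Complex.exp (2 * π * Complex.I * (⟪(!₂[f 0, f 1] : EuclideanSpace ℝ (Fin 2)), (w : EuclideanSpace ℝ (Fin 2))⟫_ℝ : ℂ))) * starRingEnd ℂ (∑ f ∈ F ((i : ℤ) + 1), Complex.exp (2 * π * Complex.I * (⟪(!₂[f 0, f 1] : EuclideanSpace ℝ (Fin 2)), (w : EuclideanSpace ℝ (Fin 2))⟫_ℝ : ℂ)))).re
                  * Real.exp (-(l * (z (((i : ℤ)) + 1) - z ((i : ℤ)))))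
                + (‖(∑ f ∈ F ((i : ℤ)), Complex.exp (2 * π * Complex.I * (⟪(!₂[f 0, f 1] : EuclideanSpace ℝ (Fin 2)), (w : EuclideanSpace ℝ (Fin 2))⟫_ℝ : ℂ)))‖ ^ 2 + ‖(∑ f ∈ F ((i : ℤ) + 1), Complex.exp (2 * π * Complex.I * (⟪(!₂[f 0, f 1] : EuclideanSpace ℝ (Fin 2)), (w : EuclideanSpace ℝ (Fin 2))⟫_ℝ : ℂ)))‖ ^ 2)
                  * Real.exp (-(2 * (l * (z (((i : ℤ)) + 1) - z ((i : ℤ)))))))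
                / (1 - Real.exp (-(2 * (l * (z (((i : ℤ)) + 1) - z ((i : ℤ)))))))
              - 2 * ((∑ f ∈ F ((i : ℤ)), Complex.exp (2 * π * Complex.I * (⟪(!₂[f 0, f 1] : EuclideanSpace ℝ (Fin 2)), (w : EuclideanSpace ℝ (Fin 2))⟫_ℝ : ℂ))) * starRingEnd ℂ
                  (∑' k : ℕ, (Real.exp (-(l * (z ((i : ℤ) + 1 + k) - z (i : ℤ)))) : ℂ)
                    * (∑ f ∈ F ((i : ℤ) + 1 + (k : ℤ)), Complex.exp (2 * π * Complex.I * (⟪(!₂[f 0, f 1] : EuclideanSpace ℝ (Fin 2)), (w : EuclideanSpace ℝ (Fin 2))⟫_ℝ : ℂ))))).re) := by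
  sorry

/-- **Composition 1 (sorry-free): the lead's open stub `stub_kernelFormNonneg`, from stubs A, B, C.** -/
theorem kernelFormNonneg_of :
    ∀ (Q : PeriodicConfiguration 3) (τu τd : ℝ → ℝ) (a b g₀ : EuclideanSpace ℝ (Fin 3))
      (z : ℤ → ℝ) (n : ℕ) (F : ℤ → Finset (EuclideanSpace ℝ (Fin 3)))
      (L : Submodule ℤ (EuclideanSpace ℝ (Fin 2))) [DiscreteTopology L] [IsZLattice ℝ L],
      (∀ x ∈ Q.points, ∀ y ∈ Q.points, x ≠ y → (2 : ℝ) / 3 ≤ dist x y) →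
      (∀ x' ∈ Q.points, ∀ y ∈ Q.points, x' 2 ≠ y 2 → (3 : ℝ) / 4 ≤ |x' 2 - y 2|) →
      (∀ t : ℝ, (∃ x ∈ Q.points, x 2 = t) →
        (t < τu t ∧ (∃ x ∈ Q.points, x 2 = τu t) ∧ (∀ x ∈ Q.points, x 2 ≤ t ∨ τu t ≤ x 2)) ∧
        (τd t < t ∧ (∃ x ∈ Q.points, x 2 = τd t) ∧ (∀ x ∈ Q.points, x 2 ≤ τd t ∨ t ≤ x 2))) →
      a ∈ Q.lattice → b ∈ Q.lattice → a 2 = 0 → b 2 = 0 → LinearIndependent ℝ ![a, b] →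
      (∀ g ∈ Q.lattice, g 2 = 0 → ∃ k l : ℤ, g = (k : ℝ) • a + (l : ℝ) • b) →
      (∀ v : EuclideanSpace ℝ (Fin 2),
        v ∈ L ↔ ∃ k l : ℤ, v = (k : ℝ) • !₂[a 0, a 1] + (l : ℝ) • !₂[b 0, b 1]) →
      g₀ ∈ Q.lattice → 0 < n → StrictMono z → (∀ i : ℤ, z (i + n) = z i + g₀ 2) →
      (∀ g ∈ Q.lattice, ∃ k : ℤ, g 2 = g₀ 2 * k) →
      (∀ y ∈ Q.points, ∃ i : ℤ, y 2 = z i) → (∀ i : ℤ, ∃ y ∈ Q.points, y 2 = z i) →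
      (∀ i : ℤ, z (i + 1) = τu (z i)) → (∀ i : ℤ, τd (z (i + 1)) = z i) →
      (∀ m : ℤ, ∀ f ∈ F m, f 2 = z m ∧ f ∈ Q.points) →
      (∀ m : ℤ, ∀ f ∈ F m, ∀ f' ∈ F m, f ≠ f' → ∀ k l : ℤ, f' ≠ f + (k : ℝ) • a + (l : ℝ) • b) →
      (∀ (m : ℤ) (y : EuclideanSpace ℝ (Fin 3)),
        (y ∈ Q.points ∧ y 2 = z m) ↔ ∃ f ∈ F m, ∃ k l : ℤ, y = f + (k : ℝ) • a + (l : ℝ) • b) →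
      (∀ m : ℤ, F (m + n) = (F m).image (fun f => f + g₀)) →
      0 ≤ ∑ i₀ ∈ Finset.range n, ∑ x ∈ F i₀,
        ∑ m ∈ Finset.range n, ∑ f' ∈ F m, ∑' v : L,
        ∑' j : ℤ,
          ((if (m : ℤ) + j * n = (i₀ : ℤ) then 0 else
              2 * lennardJones (Real.sqrt
                (‖!₂[x 0, x 1] - !₂[f' 0, f' 1] - (j : ℝ) • !₂[g₀ 0, g₀ 1]
                    - (v : EuclideanSpace ℝ (Fin 2))‖ ^ 2 + (z (i₀ : ℤ) - z ((m : ℤ) + j * n)) ^ 2)))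
            - (if (m : ℤ) + j * n = (i₀ : ℤ) then
                ∑' k : {k : ℤ // k ≠ 0},
                  (lennardJones (Real.sqrt
                      (‖!₂[x 0, x 1] - !₂[f' 0, f' 1] - (v : EuclideanSpace ℝ (Fin 2))‖ ^ 2
                        + (2 * |(k : ℝ)| * (z ((i₀ : ℤ) + 1) - z (i₀ : ℤ))) ^ 2)) +
                   lennardJones (Real.sqrt
                      (‖!₂[x 0, x 1] - !₂[f' 0, f' 1] - (v : EuclideanSpace ℝ (Fin 2))‖ ^ 2
                        + (2 * |(k : ℝ)| * (z (i₀ : ℤ) - z ((i₀ : ℤ) - 1))) ^ 2)))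
               else 0)
            - (if (m : ℤ) + j * n = (i₀ : ℤ) + 1 then
                ∑' k : ℤ, lennardJones (Real.sqrt
                  (‖!₂[x 0, x 1] - !₂[f' 0, f' 1] - (j : ℝ) • !₂[g₀ 0, g₀ 1]
                      - (v : EuclideanSpace ℝ (Fin 2))‖ ^ 2
                    + (|2 * (k : ℝ) + 1| * (z ((i₀ : ℤ) + 1) - z (i₀ : ℤ))) ^ 2))
               else 0)
            - (if (m : ℤ) + j * n = (i₀ : ℤ) - 1 then
                ∑' k : ℤ, lennardJones (Real.sqrt
                  (‖!₂[x 0, x 1] - !₂[f' 0, f' 1] - (j : ℝ) • !₂[g₀ 0, g₀ 1]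
                      - (v : EuclideanSpace ℝ (Fin 2))‖ ^ 2
                    + (|2 * (k : ℝ) + 1| * (z (i₀ : ℤ) - z ((i₀ : ℤ) - 1))) ^ 2))
               else 0)) := by
  intro Q τu τd a b g₀ z n F L _ _ hsep hgap Hτ ha hb ha2 hb2 hab hspan hLmem hg₀ hn hz hper hvert hcov
    hocc hzu hzd hFmem hFsep hFchar hFper
  rw [stub_modeSliceForm Q τu τd a b g₀ z n F L hsep hgap Hτ ha hb ha2 hb2 hab hspan hLmem hg₀ hn hz
    hper hvert hcov hocc hzu hzd hFmem hFsep hFchar hFper]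
  exact mul_nonneg (div_nonneg (by positivity) (ZLattice.covolume_pos L MeasureTheory.volume).le)
    (stub_hierarchyReduction stub_blockCore Q τu τd a b g₀ z n F L hsep hgap Hτ ha hb ha2 hb2
      hab hspan hLmem hg₀ hn hz hper hvert hcov hocc hzu hzd hFmem hFsep hFchar hFper)

/-- **Composition 2 (sorry-free; the lead's v9 bookkeeping verbatim): the per-site chessboard deficit
inequality from the horizontal-basis lemma and `kernelFormNonneg_of`.** -/
theorem deficitCore_of :
    (∀ Q : PeriodicConfiguration 3,
      (∃ c₀ : ℝ, 0 < c₀ ∧ (∃ g ∈ Q.lattice, g 2 = c₀) ∧ ∀ g ∈ Q.lattice, ∃ k : ℤ, g 2 = c₀ * k) →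
      ∃ a ∈ Q.lattice, ∃ b ∈ Q.lattice, a 2 = 0 ∧ b 2 = 0 ∧ LinearIndependent ℝ ![a, b] ∧
        ∀ g ∈ Q.lattice, g 2 = 0 → ∃ k l : ℤ, g = (k : ℝ) • a + (l : ℝ) • b) →
    ∀ (Q : PeriodicConfiguration 3) (τu τd : ℝ → ℝ),
      (∀ x ∈ Q.points, ∀ y ∈ Q.points, x ≠ y → (2 : ℝ) / 3 ≤ dist x y) →
      (∀ x ∈ Q.points, ∀ y ∈ Q.points, x 2 ≠ y 2 → (3 : ℝ) / 4 ≤ |x 2 - y 2|) →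
      (∀ t : ℝ, (∃ x ∈ Q.points, x 2 = t) →
        (t < τu t ∧ (∃ x ∈ Q.points, x 2 = τu t) ∧ (∀ x ∈ Q.points, x 2 ≤ t ∨ τu t ≤ x 2)) ∧
        (τd t < t ∧ (∃ x ∈ Q.points, x 2 = τd t) ∧ (∀ x ∈ Q.points, x 2 ≤ τd t ∨ t ≤ x 2))) →
      0 ≤ ∑ x ∈ Q.motif,
        (2 * (∑' y : {y : EuclideanSpace ℝ (Fin 3) // y ∈ Q.points ∧ y ≠ x},
                lennardJones (dist x y.1))
          - (∑' y : {y : EuclideanSpace ℝ (Fin 3) //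
                y ∈ {p : EuclideanSpace ℝ (Fin 3) | ∃ k : ℤ, ∃ x' ∈ Q.points,
                  (x' 2 = x 2 ∨ x' 2 = τu (x 2)) ∧
                  p = x' + ((2 * (τu (x 2) - x 2)) * (k : ℝ)) •
                    EuclideanSpace.single (2 : Fin 3) (1 : ℝ)} ∧ y ≠ x},
                lennardJones (dist x y.1))
          - (∑' y : {y : EuclideanSpace ℝ (Fin 3) //
                y ∈ {p : EuclideanSpace ℝ (Fin 3) | ∃ k : ℤ, ∃ x' ∈ Q.points,
                  (x' 2 = τd (x 2) ∨ x' 2 = x 2) ∧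
                  p = x' + ((2 * (x 2 - τd (x 2))) * (k : ℝ)) •
                    EuclideanSpace.single (2 : Fin 3) (1 : ℝ)} ∧ y ≠ x},
                lennardJones (dist x y.1))) := by
  intro hHB Q τu τd hsep hgap Hτ
  classical
  obtain ⟨c₀, hc₀, ⟨g₀, hg₀, hg₀2⟩, hvert⟩ := stub_verticalPeriod Q hgap
  obtain ⟨a, ha, b, hb, ha2, hb2, hab, hspan⟩ := hHB Q ⟨c₀, hc₀, ⟨g₀, hg₀, hg₀2⟩, hvert⟩
  obtain ⟨n, z, hn, hz, hzu, hzd, hper, hocc, hcov⟩ :=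
    heightEnumeration Q τu τd c₀ hgap Hτ hc₀ ⟨g₀, hg₀, hg₀2⟩ hvert
  have hper' : ∀ i : ℤ, z (i + n) = z i + g₀ 2 := fun i => by rw [hg₀2]; exact hper i
  have hvert' : ∀ g ∈ Q.lattice, ∃ k : ℤ, g 2 = g₀ 2 * k := fun g hg => by
    rw [hg₀2]; exact hvert g hg
  have hcov' : ∀ y ∈ Q.points, ∃ i : ℤ, y 2 = z i := fun y hy => by
    obtain ⟨i, hi⟩ := hcov (y 2) ⟨y, hy, rfl⟩
    exact ⟨i, hi.symm⟩
  obtain ⟨F, _hFcard, hFmem, hFsep, hFchar, hFper⟩ :=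
    layerPresentation_periodic Q a b g₀ z n ha hb ha2 hb2 hab hspan hg₀ hn hz hper' hcov'
  obtain ⟨L, hLd, hLz, hLmem⟩ := planarLattice a b ha2 hb2 hab
  haveI : DiscreteTopology L := hLd
  haveI : IsZLattice ℝ L := hLz
  rw [deficit_motif_to_layers Q τu τd a b g₀ z n F Hτ ha hb ha2 hb2 hspan hg₀ hn hz hper' hvert'
    hcov' hFmem hFsep hFchar hFper]
  rw [Finset.sum_congr rfl fun i₀ hi₀ => Finset.sum_congr rfl fun x hx =>
    deficitSite_kernelForm Q τu τd a b g₀ z n F L i₀ x hgap ha hb ha2 hb2 hab hLmem hg₀ hn hz hper'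
      hcov' hocc hzu hzd hFmem hFsep hFchar hFper (Finset.mem_range.1 hi₀) hx]
  exact kernelFormNonneg_of Q τu τd a b g₀ z n F L hsep hgap Hτ ha hb ha2 hb2 hab hspan hLmem hg₀ hn hz
    hper' hvert' hcov' hocc hzu hzd hFmem hFsep hFchar hFper

/-- **Composition 3 (sorry-free): the landed reduction `stub_reduction` (p113745) applied to the per-site
deficit inequality closes the crux BY NAME.** -/
theorem LjPlaneChessboard_of :
    Summit.AtomisticToContinuum.Crystallization.Theses.ChessboardParticlePlanes.LjPlaneChessboard :=
  stub_reduction (deficitCore_of stub_horizontalBasis)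

end Summit.AtomisticToContinuum.Crystallization.Cruxes.LjPlaneChessboard.TwoLayerMargin

end
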